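import Literature.AlgebraicTopology.FundamentalGroup.PunctureIndependence
import Literature.AlgebraicTopology.FundamentalGroup.PuncturedSurfaceFreeFundamentalGroup
import Literature.Geometry.Kaehler.RiemannSurfaceSeparatesPoints
import Literature.Geometry.Kaehler.RiemannSurfaceBranchedCovering
import Mathlib.Topology.Homotopy.Lifting
import HarnessLib

/-!
# The fundamental group of a punctured compact Riemann surface is free of finite rank — proof

Topic `Literature/AlgebraicTopology/FundamentalGroup`.  This file DISCHARGES the named fact
`PuncturedCompactRiemannSurfaceFreePi1` (W. S. Massey, *Algebraic Topology: An Introduction* (1967),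
Ch. 4 §5; stated in `PuncturedSurfaceFreeFundamentalGroup.lean`): for a compact connected Riemann
surface `M`, a finite non-empty `S ⊆ M` with `M ∖ S` connected and any base point,
`π₁(M ∖ S)` is free of finite rank — `puncturedCompactRiemannSurfaceFreePi1_holds`.

PROOF (analytic route; no triangulation / CW structure / classification of surfaces is used).
* §1 For a covering map `p : E → X` the induced map `π₁(E, e) → π₁(X, p e)` is injective (Mathlib's
  `IsCoveringMap.injective_path_homotopic_map`) and its image is the stabiliser of `e` under the
  monodromy action on the fibre (the lifting correspondence, Hatcher Prop. 1.31 / §1.3, via Mathlib's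
  `IsCoveringMap.liftPathQuotient`, `monodromy_eq_of_map_eq`); for a finite fibre the image therefore
  has finite index (`MulAction.index_stabilizer`), so `π₁(E)` is free of finite rank as soon as `π₁(X)`
  is (`IsFreeOfFiniteRank.of_injective_of_finiteIndex`: Nielsen–Schreier and Schreier's finite
  generation, Hatcher Prop. 1.32 / Thm. 1A.4).
* §2 `(ℂ ∪ {∞}) ∖ B ≅ ℂ ∖ B` for `B ∋ ∞` finite, whose `π₁` is free of finite rank (the tree's
  `nonempty_mulEquiv_freeGroup_compl_finite`).
* §3 A non-constant holomorphic map `F : M → ℂ ∪ {∞}` from a compact connected Riemann surface is a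
  covering map off its finitely many branch values (the tree's `RiemannSurface.isCoveringMapOn`,
  `finite_branchValues`, Farkas–Kra I.1.6) with finite fibres (`finite_preimage_singleton`); removing
  also `∞` and one more value, `M ∖ F⁻¹(B)` is a finite-sheeted covering space of `ℂ ∖ B`, so
  `π₁(M ∖ S')` is free of finite rank for the finite non-empty `S' = F⁻¹(B)`.
* §4 Such an `F` exists by `RiemannSurface.separatesPoints_meromorphicFunctions` (Forster 14.12/14.13,
  from the tree's Cartan–Serre finiteness theorem), and freeness of finite rank passes from `S'` to the
  given `S` by puncture independence (`PunctureIndependence.isFreeOfFiniteRank_fundamentalGroup_compl_of_compl`,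
  van Kampen: two punctures in one chart add a free factor `ℤ`).

Main statements: `BranchedCoverFreePi1.injective_mapOfEq`, `…range_mapOfEq_eq_stabilizer`,
`…finiteIndex_range_mapOfEq`, `…isFreeOfFiniteRank_of_isCoveringMap`, `…isFreeOfFiniteRank_sphere_compl`,
`…exists_finite_compl_isFreeOfFiniteRank`, and **`puncturedCompactRiemannSurfaceFreePi1_holds`**.
Everything is proved; no definitions, no instances, no named facts.
Classical; it closes the topological input (α) of the punctured cell of the abc-iut cell's geometric
column of [AbsTopIII] Prop. 4.2 (i) / Cor. 4.5 (abc-iut-w5-d096's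
`ArchimedeanHolFieldFunctorGeometricPSLPuncturedGenuineZeroResidual`); nothing here bears on
[IUTchIII] Cor. 3.12.

## References
* W. S. Massey, *Algebraic Topology: An Introduction*, GTM 56 (1967/1977), Ch. 4 §5.
  [Massey1967AlgebraicTopology]
* A. Hatcher, *Algebraic Topology*, CUP (2002), §1.3 Prop. 1.31, Prop. 1.32; §1.A Thm. 1A.4;
  §1.2 Example 1.22. [HatcherAT2002]
* H. M. Farkas, I. Kra, *Riemann Surfaces*, GTM 71, 2nd ed. (1992), §I.1.6. [FarkasKra1992]
* O. Forster, *Lectures on Riemann Surfaces*, GTM 81 (1981), §14 Thm. 14.12, Cor. 14.13. [Forster1981]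
-/

noncomputable section

open Set Function Metric
open scoped Topology

namespace Literature.AlgebraicTopology.FundamentalGroup

namespace BranchedCoverFreePi1

open Literature.IUT.HodgeTheaters (IsFreeOfFiniteRank)

/-! ### §1 Covering maps: `π₁` of the total space embeds with finite index -/

section Covering

variable {E X : Type*} [TopologicalSpace E] [TopologicalSpace X] {p : E → X}

/-- **A covering map is injective on fundamental groups** (Mathlib's
`IsCoveringMap.injective_path_homotopic_map` read on `π₁`). [cite: HatcherAT2002, Prop. 1.31] -/
theorem injective_mapOfEq (cov : IsCoveringMap p) (e : E) :
    Function.Injective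
      (_root_.FundamentalGroup.mapOfEq (⟨p, cov.continuous⟩ : C(E, X)) (rfl : p e = p e)) := by
  intro a b hab
  rw [_root_.FundamentalGroup.mapOfEq_apply, _root_.FundamentalGroup.mapOfEq_apply,
    Path.Homotopic.Quotient.cast_rfl_rfl, Path.Homotopic.Quotient.cast_rfl_rfl] at hab
  exact cov.injective_path_homotopic_map e e hab

/-- **The image of `π₁` of the total space is the stabiliser of the chosen point of the fibre under
the monodromy action** (the lifting correspondence). [cite: HatcherAT2002, Prop. 1.31 and §1.3] -/
theorem range_mapOfEq_eq_stabilizer (cov : IsCoveringMap p) {x : X} (e : p ⁻¹' {x}) :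
    letI := cov.fundamentalGroupMulAction x
    (_root_.FundamentalGroup.mapOfEq (⟨p, cov.continuous⟩ : C(E, X)) e.2).range =
      MulAction.stabilizer (_root_.FundamentalGroup X x) e := by
  letI := cov.fundamentalGroupMulAction x
  ext γ
  rw [MonoidHom.mem_range, MulAction.mem_stabilizer_iff]
  change (∃ δ, _) ↔ cov.monodromy γ e = e
  constructor
  · rintro ⟨δ, rfl⟩
    refine cov.monodromy_eq_of_map_eq δ ?_
    rw [_root_.FundamentalGroup.mapOfEq_apply, Path.Homotopic.Quotient.cast_cast,
      Path.Homotopic.Quotient.cast_rfl_rfl]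
  · intro h
    refine ⟨(cov.liftPathQuotient γ e).cast rfl (congrArg Subtype.val h.symm), ?_⟩
    rw [_root_.FundamentalGroup.mapOfEq_apply, Path.Homotopic.Quotient.map_cast,
      IsCoveringMap.map_liftPathQuotient, Path.Homotopic.Quotient.cast_cast,
      Path.Homotopic.Quotient.cast_cast, Path.Homotopic.Quotient.cast_rfl_rfl]

/-- **For a finite fibre the image of `π₁` of the total space has finite index** (index of the
stabiliser = size of the orbit). [cite: HatcherAT2002, Prop. 1.32] -/
theorem finiteIndex_range_mapOfEq (cov : IsCoveringMap p) {x : X} (e : p ⁻¹' {x})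
    (hfin : (p ⁻¹' {x}).Finite) :
    (_root_.FundamentalGroup.mapOfEq (⟨p, cov.continuous⟩ : C(E, X)) e.2).range.FiniteIndex := by
  letI := cov.fundamentalGroupMulAction x
  haveI : Finite (p ⁻¹' {x}) := hfin.to_subtype
  rw [range_mapOfEq_eq_stabilizer cov e]
  refine ⟨?_⟩
  rw [MulAction.index_stabilizer]
  exact (Set.ncard_pos (Set.toFinite _)).2 (MulAction.nonempty_orbit e) |>.ne'

/-- **A covering space with finite fibre over a space with free `π₁` of finite rank has free `π₁` of
finite rank** (Nielsen–Schreier with Schreier's finite generation). [cite: HatcherAT2002, Prop. 1.32 with Thm. 1A.4] -/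
theorem isFreeOfFiniteRank_of_isCoveringMap (cov : IsCoveringMap p) (e : E)
    (hfin : (p ⁻¹' {p e}).Finite) (hX : IsFreeOfFiniteRank (_root_.FundamentalGroup X (p e))) :
    IsFreeOfFiniteRank (_root_.FundamentalGroup E e) :=
  IsFreeOfFiniteRank.of_injective_of_finiteIndex hX _ (injective_mapOfEq cov e)
    (finiteIndex_range_mapOfEq cov ⟨e, rfl⟩ hfin)

end Covering

/-! ### §2 The sphere minus a finite set containing `∞` -/

section Sphere

open OnePoint

/-- `(ℂ ∪ {∞}) ∖ B ≃ ℂ ∖ B` for `B` finite with `∞ ∈ B` (`z ↦ ↑z` is a continuous open bijection).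
[cite: FarkasKra1992, §I.1.3 (the sphere `ℂ ∪ {∞}`; folklore)] -/
theorem nonempty_sphereComplHomeomorph (B : Set (OnePoint ℂ)) (hBf : B.Finite) (hB : ∞ ∈ B) :
    Nonempty (↥(Bᶜ : Set (OnePoint ℂ)) ≃ₜ ↥((((↑) : ℂ → OnePoint ℂ) ⁻¹' B)ᶜ : Set ℂ)) := by
  let g : ↥((((↑) : ℂ → OnePoint ℂ) ⁻¹' B)ᶜ : Set ℂ) → ↥(Bᶜ : Set (OnePoint ℂ)) :=
    fun z => ⟨(z : ℂ), z.2⟩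
  have hg_cont : Continuous g := (continuous_coe.comp continuous_subtype_val).subtype_mk _
  have hg_inj : Function.Injective g := fun a b h =>
    Subtype.ext (coe_injective (congrArg Subtype.val h))
  have hg_surj : Function.Surjective g := by
    rintro ⟨y, hy⟩
    have hy' : y ≠ ∞ := fun h => hy (h ▸ hB)
    obtain ⟨z, hz⟩ := ne_infty_iff_exists.1 hy'
    subst hz
    exact ⟨⟨z, hy⟩, rfl⟩
  have hC : IsOpen ((((↑) : ℂ → OnePoint ℂ) ⁻¹' B)ᶜ : Set ℂ) :=
    (hBf.preimage coe_injective.injOn).isClosed.isOpen_compl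
  have hg_open : IsOpenMap g := by
    intro U hU
    have hO : IsOpen (((↑) : ℂ → OnePoint ℂ) '' (Subtype.val '' U)) :=
      isOpenMap_coe _ (hC.isOpenMap_subtype_val U hU)
    rw [isOpen_induced_iff]
    refine ⟨_, hO, ?_⟩
    ext y
    constructor
    · rintro ⟨z, ⟨u, hu, rfl⟩, hz⟩
      exact ⟨u, hu, Subtype.ext hz⟩
    · rintro ⟨u, hu, rfl⟩
      exact ⟨(u : ℂ), ⟨u, hu, rfl⟩, rfl⟩
  exact ⟨((Equiv.ofBijective g ⟨hg_inj, hg_surj⟩).toHomeomorphOfContinuousOpen hg_cont hg_open).symm⟩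

/-- **The sphere minus a finite set containing `∞` has free `π₁` of finite rank** (it is the plane
minus a finite set). [cite: HatcherAT2002, §1.2 Example 1.22] -/
theorem isFreeOfFiniteRank_sphere_compl {B : Set (OnePoint ℂ)} (hBf : B.Finite) (hB : ∞ ∈ B)
    (y : ↥(Bᶜ : Set (OnePoint ℂ))) : IsFreeOfFiniteRank (_root_.FundamentalGroup ↥(Bᶜ : Set (OnePoint ℂ)) y) := by
  obtain ⟨g⟩ := nonempty_sphereComplHomeomorph B hBf hB
  have hF : ((((↑) : ℂ → OnePoint ℂ) ⁻¹' B) : Set ℂ).Finite := hBf.preimage coe_injective.injOn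
  obtain ⟨e⟩ := nonempty_mulEquiv_freeGroup_compl_finite hF (g y)
  exact IsFreeOfFiniteRank.congr ((g.fundamentalGroupMulEquiv rfl).trans e).symm
    (isFreeOfFiniteRank_freeGroup_fin _)

end Sphere

/-! ### §3 A branched cover of the sphere has a finite puncture set with free `π₁` -/

section Branched

open scoped Manifold ContDiff
open Literature.Geometry.Kaehler RiemannSurface

variable {M : Type*} [TopologicalSpace M] [ChartedSpace ℂ M] [IsManifold 𝓘(ℂ, ℂ) ω M]
  [CompactSpace M] [T2Space M] [PreconnectedSpace M]

/-- **Off the branch values and the poles, a non-constant holomorphic map to the sphere exhibits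
`M ∖ S'` as a finite-sheeted covering space of the plane minus finitely many points, so
`π₁(M ∖ S')` is free of finite rank** for the finite set `S' = F⁻¹(branch values ∪ {∞, F x₀})`.
[cite: FarkasKra1992, §I.1.6; HatcherAT2002, Prop. 1.31, Thm. 1A.4] -/
theorem exists_finite_compl_isFreeOfFiniteRank {F : M → OnePoint ℂ}
    (hF : MDifferentiable 𝓘(ℂ, ℂ) 𝓘(ℂ, ℂ) F) (hne : ∃ x y, F x ≠ F y) (x₀ : M) :
    ∃ S' : Set M, S'.Finite ∧ x₀ ∈ S' ∧
      ∀ z : ↥(S'ᶜ : Set M), IsFreeOfFiniteRank (_root_.FundamentalGroup ↥(S'ᶜ : Set M) z) := by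
  classical
  -- branch values, `∞` and `F x₀`
  set V₀ : Set (OnePoint ℂ) := {Q | ∀ P, F P = Q → ramificationNumber F P = 1} with hV₀
  have hcov : IsCoveringMapOn F V₀ := RiemannSurface.isCoveringMapOn hF hne
  set B : Set (OnePoint ℂ) := V₀ᶜ ∪ ({(OnePoint.infty : OnePoint ℂ)} ∪ {F x₀}) with hBdef
  have hBf : B.Finite :=
    (finite_branchValues hF hne).union ((Set.finite_singleton _).union (Set.finite_singleton _))
  have hB : (OnePoint.infty : OnePoint ℂ) ∈ B := Or.inr (Or.inl rfl)
  have hx₀B : F x₀ ∈ B := Or.inr (Or.inr rfl)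
  have hVB : Bᶜ ⊆ V₀ := fun Q hQ => by
    by_contra h; exact hQ (Or.inl h)
  refine ⟨F ⁻¹' B, hBf.preimage' fun b _ => finite_preimage_singleton hF hne b, hx₀B, fun z => ?_⟩
  -- the covering `F⁻¹(Bᶜ) → Bᶜ`
  have hcovB : IsCoveringMap ((Bᶜ).restrictPreimage F) := (hcov.mono hVB).isCoveringMap_restrictPreimage
  have hz : F (z : M) ∈ Bᶜ := z.2
  -- finite fibre
  have hfib : (((Bᶜ).restrictPreimage F) ⁻¹' {(Bᶜ).restrictPreimage F z}).Finite := by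
    refine ((finite_preimage_singleton hF hne (F z)).preimage Subtype.val_injective.injOn).subset ?_
    intro w hw
    have : (Bᶜ).restrictPreimage F w = (Bᶜ).restrictPreimage F z := hw
    exact congrArg Subtype.val this
  have hX := isFreeOfFiniteRank_sphere_compl hBf hB ((Bᶜ).restrictPreimage F z)
  exact isFreeOfFiniteRank_of_isCoveringMap hcovB z hfib hX

end Branched

end BranchedCoverFreePi1

/-! ### §4 The named fact -/

section Holds

open scoped Manifold ContDiff
open Literature.Geometry.Kaehler
open Literature.IUT.HodgeTheaters (IsFreeOfFiniteRank)

/-- **The fundamental group of a punctured compact Riemann surface is free of finite rank** — the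
named fact `PuncturedCompactRiemannSurfaceFreePi1` (Massey Ch. 4 §5) DISCHARGED: a non-constant
meromorphic function (`RiemannSurface.separatesPoints_meromorphicFunctions`, from the Cartan–Serre
finiteness theorem) makes `M ∖ S'` a finite covering of the plane minus finitely many points for SOME
finite `S'` (branch values and poles removed), whence `π₁(M ∖ S')` is free of finite rank
(Nielsen–Schreier, Schreier index); and freeness of finite rank does not depend on the finite
non-empty puncture set (`PunctureIndependence.isFreeOfFiniteRank_fundamentalGroup_compl_of_compl`:
two punctures in one chart add a free factor `ℤ`, van Kampen). [cite: Massey1967AlgebraicTopology, Ch. 4 §5] -/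
theorem puncturedCompactRiemannSurfaceFreePi1_holds : PuncturedCompactRiemannSurfaceFreePi1 := by
  intro M _ _ _ _ _ _ S hS hSne _ x
  obtain ⟨s, hs⟩ := hSne
  have hxs : (x : M) ≠ s := fun h => x.2 (h ▸ hs)
  obtain ⟨F, hFmer, hFne⟩ := RiemannSurface.separatesPoints_meromorphicFunctions hxs
  obtain ⟨S', hS'f, hsS', hfree⟩ :=
    BranchedCoverFreePi1.exists_finite_compl_isFreeOfFiniteRank hFmer.1 ⟨_, _, hFne⟩ s
  -- `M` is infinite (connected, Hausdorff, two points), so `M ∖ S'` has a point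
  haveI : Nontrivial M := ⟨⟨x, s, hxs⟩⟩
  haveI : Infinite M := PreconnectedSpace.infinite
  obtain ⟨y, hy⟩ : ∃ y, y ∉ S' := by
    by_contra h
    simp only [not_exists, not_not] at h
    exact Set.infinite_univ (hS'f.subset fun y _ => h y)
  exact PunctureIndependence.isFreeOfFiniteRank_fundamentalGroup_compl_of_compl hS ⟨s, hs⟩ hS'f
    ⟨s, hsS'⟩ ⟨y, hy⟩ (hfree ⟨y, hy⟩) x

end Holds

end Literature.AlgebraicTopology.FundamentalGroup

end
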